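import Literature.AlgebraicGeometry.HodgeTheory.WeilClassesSixfoldsProofs
import Literature.AlgebraicGeometry.HodgeTheory.WeilClassesFourfoldsProofs
import Literature.AlgebraicGeometry.HodgeTheory.AlgebraicClassesExteriorProduct
import Literature.AlgebraicGeometry.HodgeTheory.WeilClassesRationalPlane
import Literature.AlgebraicGeometry.HodgeTheory.WeilClassesHodgeType
import Literature.AlgebraicGeometry.HodgeTheory.HyperbolicWeilTypeBalanced
import Literature.AlgebraicGeometry.HodgeTheory.LefschetzOneOneHolds
import Literature.AlgebraicGeometry.HodgeTheory.WeilClassesIsogenyDescent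
import Literature.AlgebraicGeometry.Motives.AimedSplitProductProofs
import Literature.AlgebraicGeometry.Motives.AbelianVarietyCohomologyExteriorH1
import HarnessLib

/-!
# Weil classes of a product from the Weil classes of its factors (Schoen 1998 §10 read downward)

Family `hodge`, layer `Literature/AlgebraicGeometry/HodgeTheory`. Sibling of `WeilClassesProducts`
(the UPWARD half of Schoen's product step: from the Weil plane of a product `A₁ × A₂` to the Weil
components of the factors, Compositio 114 §10 Proposition, as used in Markman's arXiv:2509.23403
§11.5 Step 2 to pass from split sixfolds DOWN to fourfolds of arbitrary discriminant). This file
proves the converse, elementary, direction on the tree's real carriers, in ALL pairs of dimensions,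
with no hypothesis left and no named fact introduced:

* `weilClassesOf_prod_le_algebraicClasses` — **the DOWNWARD product step.** For complex abelian
  varieties `A₁`, `A₂` of dimensions `2n₁`, `2n₂` (`nᵢ ≥ 1`) with `φᵢ ≫ φᵢ = -(d • 𝟙 Aᵢ)`, `d ≥ 1`
  (the same `K = ℚ(√-d)` acting on both), if the Weil planes `weilClassesOf Aᵢ φᵢ nᵢ d = W_K(Aᵢ) ⊗ ℂ`
  consist of algebraic classes, then so does the Weil plane of the product `A₁ × A₂` for the diagonal
  action `φ₁ × φ₂ = prodLift (fst ≫ φ₁) (snd ≫ φ₂)`, in degree `2(n₁ + n₂)`. Schoen's display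
  (p. 333) "`W_{A×A'} ⊗_ℚ ℂ : {ω_{1,σᵢ} ∧ ⋯ ∧ ω_{6,σᵢ}}_{1≤i≤2}`" `= (ω_{1,σᵢ} ∧ ⋯ ∧ ω_{4,σᵢ}) ∧
  (ω_{5,σᵢ} ∧ ω_{6,σᵢ})`, i.e. `W_K(A₁ × A₂) = W_K(A₁) · W_K(A₂)`; van Geemen, LNM 1594, proof of
  Thm. 6.12: the Weil lines are `⋀²ⁿ W` and `⋀²ⁿ W^*`. PROOF on the carriers: each Weil line
  `E±` is one-dimensional (`finrank_weilClassesPlus_eq_one`, from `H•(A(ℂ)) = ⋀• H¹`, Hopf, and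
  `b₁ = 2 dim`, both PROVED in the tree), so `E₊(A₁ × A₂)` is spanned by the exterior product
  `pr₁^* u₁ ∪ pr₂^* u₂` of generators `uᵢ` of `E₊(Aᵢ)` (`cupProduct_map_fst_map_snd_mem_weilClassesPlus`;
  it is NON-ZERO by the uniqueness half of the Künneth theorem,
  `Motives.cupProduct_map_fst_map_snd_ne_zero`), which is algebraic as an exterior product of
  algebraic classes (`cupProduct_map_fst_map_snd_mem_algebraicClasses`, Voisin II Prop. 9.20); one
  non-zero algebraic Weil class makes the whole plane algebraic
  (`weilClassesOf_le_algebraicClasses_of_exists_ne_zero`, complex conjugation for the other line).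
* `weilClassesOf_le_algebraicClasses_of_forall_isRationalClass` — the bridge between the POINTWISE
  shape of the tree's Weil-class facts and rungs ("every rational `(m,m)`-class of the Weil plane is
  algebraic") and the SUBMODULE shape `W ⊗ ℂ ≤ Nᵐ` used above, for `(A, φ)` of balanced Weil type
  `(m, m)` (`dim (V₊ ∩ H^{1,0}) = m`): the plane is spanned by rational classes
  (`weilClassesOf_eq_span_isRationalClass`, van Geemen 4.9) and all its classes are of type `(m, m)`
  (`isOfHodgeType_of_mem_weilClassesOf`, Deligne–Milne Prop. 4.4).
* `weilClassesOf_le_algebraicClasses_surface` — **abelian SURFACES of Weil type `(1,1)`: the Weil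
  plane is algebraic**, unconditionally (its rational classes are `(1,1)`, Lefschetz `(1,1)`,
  DISCHARGED in the tree: `lefschetzOneOne_rational_holds`).
* `weilClassesOf_le_algebraicClasses_of_isHyperbolicWeilType` — the bridge for HYPERBOLIC `(A, φ)`
  (hyperbolic ⟹ balanced, `finrank_eigenspace_inf_hodgeOneZero_eq_of_isHyperbolicWeilType`).
* `weilClassesOf_surface_prod_surface_le`, `weilClassesOf_surface_prod_surface_prod_surface_le` —
  UNCONDITIONAL instances: products of two (fourfold) and three (sixfold) Weil-type surfaces.
  The consequences in the typing of the named facts F1 / F2 / Markman 2023 (product SIXFOLDS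
  `X⁴ × S²`, product EIGHTFOLDS `X⁴ × Y⁴`, `A⁶ × S²`) are in the sibling
  `WeilClassesProductsOfFactorsFacts`.
* `mem_algebraicClasses_of_isogeny_prod` — the isogeny-closed form (an abelian variety with a
  `K`-equivariant isogeny pair towards `A₁ × A₂`), by `mem_algebraicClasses_of_isogeny_of_mem_weilClassesOf`.

## Why this matters for the non-split sixfold problem (census remark; NOT formalised here)

The discriminant `δ ∈ ℚ^×/Nm(K^×)` of a polarized abelian variety of Weil type is multiplicative
under products (Markman, arXiv:2509.23403 §11.5 Step 2: "The discriminant invariant … is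
multiplicative under cartesian products. Every value in `ℚ^×/Nm_{K/ℚ}(K^×)` is realized as the
discriminant by some connected component of moduli in every even dimension [van-Geemen]"), and the
Weil plane `W_K(A)` does not depend on the polarization. Markman uses products `X × S` to make a
sixfold SPLIT and descend to `X`; read the other way, for a fourfold `X` of split type
(`δ_X = 1`, Weil classes algebraic by the REFEREED [Markman 2023, JEMS 25, Thm. 1.5 (= Thm. 13.4),
p. 236; numbered Thm. 1.3 in the pre-v4 arXiv text 1805.11574]) and an abelian
surface `S` of Weil type of discriminant `δ_S` — for `δ_S ≠ -1` these are the QM surfaces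
`End⁰(S) ⊇ D = (-d, -δ_S)_ℚ ∋ K`, `D` a division algebra, whose `K`-Hermitian plane
`H¹(S, ℚ) ≅ D` is anisotropic (`H(v,v) ∝ Nrd(v)`) — the product `X × S` is a Weil-type SIXFOLD of
discriminant `δ_X δ_S = δ_S`, and for `X` simple (`Hom(X, S) = 0`, `NS(X × S) = NS(X) ⊕ NS(S)`) EVERY
`K`-compatible polarization of `X × S` has this class. Hence every component `(K, n = 3, δ)` of the
`9`-dimensional moduli of polarized abelian sixfolds of Weil type — split or NOT — contains the
`5`-dimensional product loci `{X × S}` on which the Weil classes are algebraic with a refereed trust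
base {Markman 2023 Thm. 1.5 (= Thm. 13.4), Lefschetz (1,1)}; with F1 (arXiv:2502.03415, unrefereed)
`X` may have any
discriminant. These are NON-GENERIC members (products); the general member of a non-split
component (`End⁰ = K`, `ρ = 1`) is untouched — Mostaed, arXiv:2603.20268 p. 3: "outside this locus,
the Hodge conjecture for Weil classes on sixfolds remains completely open".

## References

* [Schoen1998HodgeWeilAddendum] C. Schoen, Addendum to: Hodge classes on self-products of a variety
  with an automorphism, Compositio Math. 114 (1998) 329–336, §10 (Proposition and proof, pp. 332–333).
* [Markman2025SurveySecant] E. Markman, Secant sheaves and Weil classes on abelian varieties,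
  arXiv:2509.23403 (ICM 2026 survey, SIAM), Thm. 1.2 and §11.5 Steps 1–2.
* [Markman2023GeneralizedKummers] E. Markman, The monodromy of generalized Kummer varieties and
  algebraic cycles on their intermediate Jacobians, JEMS 25 (2023) 231–321, Thm. 1.5 (= Thm. 13.4),
  p. 236 (= Thm. 1.3 of the pre-v4 arXiv text 1805.11574).
* [vanGeemen1994HodgeAV] B. van Geemen, An introduction to the Hodge conjecture for abelian
  varieties, LNM 1594 (1994), 4.9–4.10, Lemma 5.2, proof of Thm. 6.12.
* [Deligne1982HodgeCycles] P. Deligne (notes by J. S. Milne), Hodge cycles on abelian varieties,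
  LNM 900 (1982), §4 (4.3)–(4.4), Prop. 4.4.
* [VoisinHodgeII2003] C. Voisin, Hodge Theory and Complex Algebraic Geometry II, proof of Prop. 9.20.
* [HatcherAT2002] A. Hatcher, Algebraic Topology, §3.2 Thm. 3.16.
* [Mostaed2026NonsplitSixfolds] A. Mostaed, arXiv:2603.20268, p. 3.
-/

noncomputable section

open CategoryTheory MonoidalCategory CartesianMonoidalCategory

namespace Literature.AlgebraicGeometry.HodgeTheory

open Literature.AlgebraicTopology.SingularHomology
open Literature.AlgebraicGeometry.Motives (IsSmoothProjective)

section HodgeTheory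

/-! ### Künneth: an exterior product of non-zero classes is non-zero (degree bookkeeping) -/

/-- **`pr_Y^* x ∪ pr_Z^* y ≠ 0` for `x ≠ 0`, `y ≠ 0`** on smooth projective `Y`, `Z`, in the degree
presentation `p + q = k` used by the Weil-class files (the tree's
`Motives.cupProduct_map_fst_map_snd_ne_zero`, uniqueness half of the Künneth theorem, is stated with
`x` in degree `k - q`). [cite: HatcherAT2002, §3.2 Thm. 3.16] -/
theorem cupProduct_map_fst_map_snd_ne_zero_of_add_eq {m n : ℕ} {Y Z : Motives.SchemeOver ℂ}
    (hY : IsSmoothProjective m Y) (hZ : IsSmoothProjective n Z) {p q k : ℕ} (hpq : p + q = k)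
    (hq : q ≤ 2 * n) {x : complexBetti Y p} {y : complexBetti Z q} (hx : x ≠ 0) (hy : y ≠ 0) :
    cupProduct hpq (complexBetti.map (fst Y Z) p x) (complexBetti.map (snd Y Z) q y) ≠ 0 := by
  obtain rfl : p = k - q := by omega
  exact Motives.cupProduct_map_fst_map_snd_ne_zero hY hZ (by omega) hq hx hy

/-! ### The downward product step -/

variable {A₁ A₂ : Motives.AbelianVariety ℂ}

/-- A one-dimensional Weil line contains a non-zero class. [folklore] -/
theorem exists_mem_ne_zero_weilClassesPlus {A : Motives.AbelianVariety ℂ} {n d : ℕ} (hA : A.dim = 2 * n)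
    (hd : 0 < d) {φ : A ⟶ A} (hφ : φ ≫ φ = -(d • 𝟙 A)) :
    ∃ u ∈ weilClassesPlus A φ n d, u ≠ 0 := by
  have hΛ := Motives.AbelianVariety.hasExteriorCohomologyH1_complexPoints A
  have hb₁ : Module.finrank ℂ (complexBetti A.X 1) = 2 * (2 * n) := by
    rw [Motives.AbelianVariety.finrank_complexBetti_one, hA]
  have h1 := finrank_weilClassesPlus_eq_one hΛ hb₁ hd hφ
  have hne : weilClassesPlus A φ n d ≠ ⊥ := by
    intro h
    rw [h, finrank_bot] at h1
    exact zero_ne_one h1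
  obtain ⟨u, hu, hu0⟩ := Submodule.exists_mem_ne_zero_of_ne_bot hne
  exact ⟨u, hu, hu0⟩

/-- **The downward product step (Schoen 1998 §10 read downward; all dimensions).** Let `A₁`, `A₂`
be complex abelian varieties of dimensions `2n₁`, `2n₂` (`n₁, n₂ ≥ 1`) with endomorphisms
`φᵢ ≫ φᵢ = -(d • 𝟙 Aᵢ)`, `d ≥ 1`. If the Weil planes `weilClassesOf A₁ φ₁ n₁ d ⊆ H^{2n₁}(A₁(ℂ); ℂ)`
and `weilClassesOf A₂ φ₂ n₂ d` consist of algebraic classes, then the Weil plane of the product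
`A₁ × A₂` with the diagonal action `φ₁ × φ₂ = prodLift (fst ≫ φ₁) (snd ≫ φ₂)`, in degree
`2(n₁ + n₂)`, consists of algebraic classes: `W_K(A₁ × A₂) ⊗ ℂ = E₊ ⊕ E₋` with
`E₊(A₁ × A₂) = ℂ · (pr₁^* u₁ ∪ pr₂^* u₂)` for generators `uᵢ` of the lines `E₊(Aᵢ)` (Schoen:
"`W_{A×A'} ⊗ ℚ ℂ : {ω_{1,σᵢ} ∧ ⋯ ∧ ω_{6,σᵢ}}`"; the exterior product is non-zero by Künneth and
algebraic as an exterior product of algebraic classes), and one non-zero algebraic Weil class makes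
the plane algebraic. [cite: Schoen1998HodgeWeilAddendum, §10 (proof, p. 333)]
[cite: vanGeemen1994HodgeAV, 4.9 and proof of Thm. 6.12] [cite: VoisinHodgeII2003, proof of Prop. 9.20] -/
theorem weilClassesOf_prod_le_algebraicClasses {n₁ n₂ d : ℕ} (hn₁ : 0 < n₁) (hd : 0 < d)
    (hA₁ : A₁.dim = 2 * n₁) (hA₂ : A₂.dim = 2 * n₂) {φ₁ : A₁ ⟶ A₁} {φ₂ : A₂ ⟶ A₂}
    (hφ₁ : φ₁ ≫ φ₁ = -(d • 𝟙 A₁)) (hφ₂ : φ₂ ≫ φ₂ = -(d • 𝟙 A₂))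
    (h₁ : weilClassesOf A₁ φ₁ n₁ d ≤ algebraicClasses A₁.X n₁)
    (h₂ : weilClassesOf A₂ φ₂ n₂ d ≤ algebraicClasses A₂.X n₂) :
    weilClassesOf (A₁.prod A₂)
        (Motives.AbelianVariety.prodLift (Motives.AbelianVariety.fst A₁ A₂ ≫ φ₁)
          (Motives.AbelianVariety.snd A₁ A₂ ≫ φ₂)) (n₁ + n₂) d ≤
      algebraicClasses (A₁.prod A₂).X (n₁ + n₂) := by
  -- carriers of the product
  have hΛ := Motives.AbelianVariety.hasExteriorCohomologyH1_complexPoints (A₁.prod A₂)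
  have hdim : (A₁.prod A₂).dim = 2 * (n₁ + n₂) := dim_prod_eq_two_mul hA₁ hA₂
  have hb : Module.finrank ℂ (complexBetti (A₁.prod A₂).X 1) = 2 * (2 * (n₁ + n₂)) := by
    rw [Motives.AbelianVariety.finrank_complexBetti_one, hdim]
  have hΦ := prodLift_comp_self_eq_neg_nsmul hφ₁ hφ₂
  have hΦ₁ : Motives.AbelianVariety.prodLift (Motives.AbelianVariety.fst A₁ A₂ ≫ φ₁)
        (Motives.AbelianVariety.snd A₁ A₂ ≫ φ₂) ≫ Motives.AbelianVariety.fst A₁ A₂ =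
      Motives.AbelianVariety.fst A₁ A₂ ≫ φ₁ :=
    Motives.AbelianVariety.prodLift_fst _ _
  have hΦ₂ : Motives.AbelianVariety.prodLift (Motives.AbelianVariety.fst A₁ A₂ ≫ φ₁)
        (Motives.AbelianVariety.snd A₁ A₂ ≫ φ₂) ≫ Motives.AbelianVariety.snd A₁ A₂ =
      Motives.AbelianVariety.snd A₁ A₂ ≫ φ₂ :=
    Motives.AbelianVariety.prodLift_snd _ _
  have hX₁ : IsSmoothProjective (2 * n₁) A₁.X := Motives.isSmoothProjective_of_dim_eq' hA₁
  have hX₂ : IsSmoothProjective (2 * n₂) A₂.X := Motives.isSmoothProjective_of_dim_eq' hA₂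
  -- generators of the `+`-Weil lines of the factors, algebraic by hypothesis
  obtain ⟨u₁, hu₁, hu₁0⟩ := exists_mem_ne_zero_weilClassesPlus hA₁ hd hφ₁
  obtain ⟨u₂, hu₂, hu₂0⟩ := exists_mem_ne_zero_weilClassesPlus hA₂ hd hφ₂
  have ha₁ : u₁ ∈ algebraicClasses A₁.X n₁ := h₁ (weilClassesPlus_le_weilClassesOf A₁ φ₁ n₁ d hu₁)
  have ha₂ : u₂ ∈ algebraicClasses A₂.X n₂ := h₂ (weilClassesPlus_le_weilClassesOf A₂ φ₂ n₂ d hu₂)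
  -- their exterior product: a Weil class of the product, algebraic, non-zero
  have hPW := cupProduct_map_fst_map_snd_mem_weilClassesOf_of_plus hΦ₁ hΦ₂ hu₁ hu₂
  have hPalg : cupProduct (two_mul_add_two_mul n₁ n₂)
      (complexBetti.map (Motives.AbelianVariety.fst A₁ A₂).hom.hom.hom (2 * n₁) u₁)
      (complexBetti.map (Motives.AbelianVariety.snd A₁ A₂).hom.hom.hom (2 * n₂) u₂) ∈
      algebraicClasses (A₁.prod A₂).X (n₁ + n₂) :=
    cupProduct_map_fst_map_snd_mem_algebraicClasses hX₁ hX₂ ha₁ ha₂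
  have hP0 : cupProduct (two_mul_add_two_mul n₁ n₂)
      (complexBetti.map (Motives.AbelianVariety.fst A₁ A₂).hom.hom.hom (2 * n₁) u₁)
      (complexBetti.map (Motives.AbelianVariety.snd A₁ A₂).hom.hom.hom (2 * n₂) u₂) ≠ 0 :=
    cupProduct_map_fst_map_snd_ne_zero_of_add_eq hX₁ hX₂ (two_mul_add_two_mul n₁ n₂) (by omega)
      hu₁0 hu₂0
  exact weilClassesOf_le_algebraicClasses_of_exists_ne_zero (by omega) hd hΦ hΛ hb
    ⟨_, hPW, hPalg, hP0⟩

/-- **The downward product step, pointwise shape**: under the hypotheses of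
`weilClassesOf_prod_le_algebraicClasses`, every class of the Weil plane of `(A₁ × A₂, φ₁ × φ₂)` —
in particular every rational class of Hodge type `(n₁ + n₂, n₁ + n₂)` in it, the shape of the tree's
Weil-class facts and rungs — is algebraic. [cite: Schoen1998HodgeWeilAddendum, §10 (proof, p. 333)] -/
theorem mem_algebraicClasses_prod_of_mem_weilClassesOf {n₁ n₂ d : ℕ} (hn₁ : 0 < n₁) (hd : 0 < d)
    (hA₁ : A₁.dim = 2 * n₁) (hA₂ : A₂.dim = 2 * n₂) {φ₁ : A₁ ⟶ A₁} {φ₂ : A₂ ⟶ A₂}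
    (hφ₁ : φ₁ ≫ φ₁ = -(d • 𝟙 A₁)) (hφ₂ : φ₂ ≫ φ₂ = -(d • 𝟙 A₂))
    (h₁ : weilClassesOf A₁ φ₁ n₁ d ≤ algebraicClasses A₁.X n₁)
    (h₂ : weilClassesOf A₂ φ₂ n₂ d ≤ algebraicClasses A₂.X n₂) :
    ∀ c : complexBetti (A₁.prod A₂).X (2 * (n₁ + n₂)), IsRationalClass c →
      IsOfHodgeType (2 * (n₁ + n₂)) (A₁.prod A₂).X (2 * (n₁ + n₂)) (n₁ + n₂) (n₁ + n₂) c →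
        c ∈ weilClassesOf (A₁.prod A₂)
          (Motives.AbelianVariety.prodLift (Motives.AbelianVariety.fst A₁ A₂ ≫ φ₁)
            (Motives.AbelianVariety.snd A₁ A₂ ≫ φ₂)) (n₁ + n₂) d →
          c ∈ algebraicClasses (A₁.prod A₂).X (n₁ + n₂) :=
  fun _ _ _ hcW ↦ weilClassesOf_prod_le_algebraicClasses hn₁ hd hA₁ hA₂ hφ₁ hφ₂ h₁ h₂ hcW

/-! ### From the pointwise shape of the facts to `W ⊗ ℂ ≤ Nᵐ` (balanced Weil type) -/

variable {A : Motives.AbelianVariety ℂ} {m d : ℕ}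

/-- **Balanced Weil type: pointwise algebraicity of the rational `(m,m)` Weil classes gives
`W ⊗ ℂ ⊆ Nᵐ`.** For a complex abelian `2m`-fold `A` (`m ≥ 1`) with `φ ≫ φ = -(d • 𝟙 A)`, `d ≥ 1`,
of balanced Weil type (`dim (V₊ ∩ H^{1,0}) = m`): if every RATIONAL class of Hodge type `(m, m)` in
`weilClassesOf A φ m d` is algebraic (the shape of `Markman2025_weilClasses_algebraic_abelianFourfold`
and of the ladder's rungs), then the whole complex plane `weilClassesOf A φ m d` lies in the
`ℂ`-subspace `algebraicClasses A.X m` — it is spanned by its rational classes (van Geemen 4.9,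
`weilClassesOf_eq_span_isRationalClass`), all of type `(m, m)` (Deligne–Milne Prop. 4.4,
`isOfHodgeType_of_mem_weilClassesOf`). [cite: vanGeemen1994HodgeAV, 4.9–4.10]
[cite: Deligne1982HodgeCycles, Prop. 4.4] -/
theorem weilClassesOf_le_algebraicClasses_of_forall_isRationalClass (hm : 0 < m) (hA : A.dim = 2 * m)
    (hd : 0 < d) {φ : A ⟶ A} (hφ : φ ≫ φ = -(d • 𝟙 A))
    (hbal : Module.finrank ℂ ↥(Module.End.eigenspace (complexBetti.map φ.hom.hom.hom 1).hom
          (Complex.I * (Real.sqrt d : ℂ)) ⊓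
        hodgeOneZero (Motives.isSmoothProjective_of_dim_eq' hA)) = m)
    (halg : ∀ c : complexBetti A.X (2 * m), IsRationalClass c →
      IsOfHodgeType (2 * m) A.X (2 * m) m m c → c ∈ weilClassesOf A φ m d →
        c ∈ algebraicClasses A.X m) :
    weilClassesOf A φ m d ≤ algebraicClasses A.X m := by
  intro c hc
  rw [weilClassesOf_eq_span_isRationalClass hm hA hd hφ] at hc
  refine (Submodule.span_le.mpr ?_) hc
  rintro c' ⟨hcr, hcW⟩
  exact halg c' hcr (isOfHodgeType_of_mem_weilClassesOf hm hA hd hφ hbal hcW) hcW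

/-- Conversely (trivially): `W ⊗ ℂ ⊆ Nᵐ` gives the pointwise shape. [folklore] -/
theorem forall_mem_algebraicClasses_of_weilClassesOf_le {φ : A ⟶ A}
    (h : weilClassesOf A φ m d ≤ algebraicClasses A.X m) :
    ∀ c : complexBetti A.X (2 * m), IsRationalClass c →
      IsOfHodgeType (2 * m) A.X (2 * m) m m c → c ∈ weilClassesOf A φ m d →
        c ∈ algebraicClasses A.X m :=
  fun _ _ _ hcW ↦ h hcW

/-- **Abelian SURFACES of Weil type: the Weil plane is algebraic (unconditionally).** For a complex
abelian surface `S` with `φ ≫ φ = -(d • 𝟙 S)`, `d ≥ 1`, of balanced type `(1,1)`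
(`dim (V₊ ∩ H^{1,0}) = 1`), `weilClassesOf S φ 1 d ⊆ N¹ H²(S(ℂ); ℂ)`: the plane is spanned by rational
`(1,1)`-classes, which are algebraic by the rational Lefschetz `(1,1)` theorem, DISCHARGED in the tree
(`lefschetzOneOne_rational_holds`). Schoen (p. 333): "`W_{A'}` has Hodge type `(1,1)`".
[cite: Schoen1998HodgeWeilAddendum, §10 (proof, p. 333)] [cite: VoisinHodgeI2002, Thm. 11.30] -/
theorem weilClassesOf_le_algebraicClasses_surface (hA : A.dim = 2 * 1) (hd : 0 < d) {φ : A ⟶ A}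
    (hφ : φ ≫ φ = -(d • 𝟙 A))
    (hbal : Module.finrank ℂ ↥(Module.End.eigenspace (complexBetti.map φ.hom.hom.hom 1).hom
          (Complex.I * (Real.sqrt d : ℂ)) ⊓
        hodgeOneZero (Motives.isSmoothProjective_of_dim_eq' hA)) = 1) :
    weilClassesOf A φ 1 d ≤ algebraicClasses A.X 1 :=
  weilClassesOf_le_algebraicClasses_of_forall_isRationalClass one_pos hA hd hφ hbal
    fun c hcr hcH _ ↦ lefschetzOneOne_rational_holds (Motives.isSmoothProjective_of_dim_eq' hA) c hcr hcH

/-- **Hyperbolic `(A, φ)`: pointwise algebraicity gives `W ⊗ ℂ ⊆ Nⁿ`** (hyperbolic ⟹ balanced,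
Deligne's "(b) implies (4.4)", `finrank_eigenspace_inf_hodgeOneZero_eq_of_isHyperbolicWeilType`).
The hypotheses `e`, `a`, `hhyp` are those of the hyperbolic (split) facts and rungs.
[cite: Deligne1982HodgeCycles, proof of Thm. 4.8 with Prop. 4.4] [cite: vanGeemen1994HodgeAV, Lemma 5.2 (1)] -/
theorem weilClassesOf_le_algebraicClasses_of_isHyperbolicWeilType {n : ℕ} (hn : 0 < n) (hd : 0 < d)
    (hA : A.dim = 2 * n) {φ : A ⟶ A} (hφ : φ ≫ φ = -(d • 𝟙 A)) (e : Motives.ProjectiveEmbedding A.X)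
    {a : complexBetti (Motives.projectiveSpace e.n ℂ) 2} (ha : IsRationalClass a) (ha0 : a ≠ 0)
    (hhyp : Motives.IsHyperbolicWeilType A φ n
      ((d : ℂ) • complexBetti.map e.ι 2 a + complexBetti.map φ.hom.hom.hom 2 (complexBetti.map e.ι 2 a)))
    (halg : ∀ c : complexBetti A.X (2 * n), IsRationalClass c →
      IsOfHodgeType (2 * n) A.X (2 * n) n n c → c ∈ weilClassesOf A φ n d →
        c ∈ algebraicClasses A.X n) :
    weilClassesOf A φ n d ≤ algebraicClasses A.X n :=
  weilClassesOf_le_algebraicClasses_of_forall_isRationalClass hn hA hd hφ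
    (finrank_eigenspace_inf_hodgeOneZero_eq_of_isHyperbolicWeilType hn hd hA hφ e ha ha0 hhyp) halg

/-! ### Unconditional instances: products of Weil-type surfaces -/

variable {S₁ S₂ S₃ : Motives.AbelianVariety ℂ}

/-- **Products of two abelian surfaces of Weil type `(1,1)` (diagonal `K`): the Weil plane of the
FOURFOLD `S₁ × S₂` is algebraic — unconditionally** (Lefschetz `(1,1)` on the factors and the
downward product step). These are the abelian fourfolds of Weil type isogenous to a product of
Weil-type surfaces, e.g. `E⁴`-type and `S_D × S_{D'}` for QM surfaces; inside the floor F1 but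
independent of it. [cite: Schoen1998HodgeWeilAddendum, §10] [cite: vanGeemen1994HodgeAV, 4.9] -/
theorem weilClassesOf_surface_prod_surface_le {d : ℕ} (hd : 0 < d) (hS₁ : S₁.dim = 2 * 1)
    (hS₂ : S₂.dim = 2 * 1) {ψ₁ : S₁ ⟶ S₁} {ψ₂ : S₂ ⟶ S₂} (hψ₁ : ψ₁ ≫ ψ₁ = -(d • 𝟙 S₁))
    (hψ₂ : ψ₂ ≫ ψ₂ = -(d • 𝟙 S₂))
    (hbal₁ : Module.finrank ℂ ↥(Module.End.eigenspace (complexBetti.map ψ₁.hom.hom.hom 1).hom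
          (Complex.I * (Real.sqrt d : ℂ)) ⊓
        hodgeOneZero (Motives.isSmoothProjective_of_dim_eq' hS₁)) = 1)
    (hbal₂ : Module.finrank ℂ ↥(Module.End.eigenspace (complexBetti.map ψ₂.hom.hom.hom 1).hom
          (Complex.I * (Real.sqrt d : ℂ)) ⊓
        hodgeOneZero (Motives.isSmoothProjective_of_dim_eq' hS₂)) = 1) :
    weilClassesOf (S₁.prod S₂)
        (Motives.AbelianVariety.prodLift (Motives.AbelianVariety.fst S₁ S₂ ≫ ψ₁)
          (Motives.AbelianVariety.snd S₁ S₂ ≫ ψ₂)) (1 + 1) d ≤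
      algebraicClasses (S₁.prod S₂).X (1 + 1) :=
  weilClassesOf_prod_le_algebraicClasses one_pos hd hS₁ hS₂ hψ₁ hψ₂
    (weilClassesOf_le_algebraicClasses_surface hS₁ hd hψ₁ hbal₁)
    (weilClassesOf_le_algebraicClasses_surface hS₂ hd hψ₂ hbal₂)

/-- **Products of three abelian surfaces of Weil type `(1,1)`: the Weil plane of the SIXFOLD
`(S₁ × S₂) × S₃` is algebraic — unconditionally.** (A degenerate, but unconditional, locus in every
component — split or not — of the moduli of polarized Weil-type sixfolds: discriminants multiply.)
[cite: Schoen1998HodgeWeilAddendum, §10] [cite: Markman2025SurveySecant, §11.5 Step 2] -/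
theorem weilClassesOf_surface_prod_surface_prod_surface_le {d : ℕ} (hd : 0 < d) (hS₁ : S₁.dim = 2 * 1)
    (hS₂ : S₂.dim = 2 * 1) (hS₃ : S₃.dim = 2 * 1) {ψ₁ : S₁ ⟶ S₁} {ψ₂ : S₂ ⟶ S₂} {ψ₃ : S₃ ⟶ S₃}
    (hψ₁ : ψ₁ ≫ ψ₁ = -(d • 𝟙 S₁)) (hψ₂ : ψ₂ ≫ ψ₂ = -(d • 𝟙 S₂)) (hψ₃ : ψ₃ ≫ ψ₃ = -(d • 𝟙 S₃))
    (hbal₁ : Module.finrank ℂ ↥(Module.End.eigenspace (complexBetti.map ψ₁.hom.hom.hom 1).hom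
          (Complex.I * (Real.sqrt d : ℂ)) ⊓
        hodgeOneZero (Motives.isSmoothProjective_of_dim_eq' hS₁)) = 1)
    (hbal₂ : Module.finrank ℂ ↥(Module.End.eigenspace (complexBetti.map ψ₂.hom.hom.hom 1).hom
          (Complex.I * (Real.sqrt d : ℂ)) ⊓
        hodgeOneZero (Motives.isSmoothProjective_of_dim_eq' hS₂)) = 1)
    (hbal₃ : Module.finrank ℂ ↥(Module.End.eigenspace (complexBetti.map ψ₃.hom.hom.hom 1).hom
          (Complex.I * (Real.sqrt d : ℂ)) ⊓
        hodgeOneZero (Motives.isSmoothProjective_of_dim_eq' hS₃)) = 1) :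
    weilClassesOf ((S₁.prod S₂).prod S₃)
        (Motives.AbelianVariety.prodLift
          (Motives.AbelianVariety.fst (S₁.prod S₂) S₃ ≫
            Motives.AbelianVariety.prodLift (Motives.AbelianVariety.fst S₁ S₂ ≫ ψ₁)
              (Motives.AbelianVariety.snd S₁ S₂ ≫ ψ₂))
          (Motives.AbelianVariety.snd (S₁.prod S₂) S₃ ≫ ψ₃)) (1 + 1 + 1) d ≤
      algebraicClasses ((S₁.prod S₂).prod S₃).X (1 + 1 + 1) :=
  weilClassesOf_prod_le_algebraicClasses (by norm_num) hd (dim_prod_eq_two_mul hS₁ hS₂) hS₃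
    (prodLift_comp_self_eq_neg_nsmul hψ₁ hψ₂) hψ₃
    (weilClassesOf_surface_prod_surface_le hd hS₁ hS₂ hψ₁ hψ₂ hbal₁ hbal₂)
    (weilClassesOf_le_algebraicClasses_surface hS₃ hd hψ₃ hbal₃)

/-! ### The isogeny-closed form -/

/-- **The product locus is closed under `K`-equivariant isogeny.** Let `(A, φ)` be a complex abelian
`2(n₁ + n₂)`-fold with an isogeny pair towards the product: `f : A ⟶ A₁ × A₂` flat and
`g : A₁ × A₂ ⟶ A` with `g ≫ φ = (φ₁ × φ₂) ≫ g` and `f ≫ g = m • 𝟙 A`, `m ≥ 1`. If the Weil planes of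
`(A₁, φ₁)`, `(A₂, φ₂)` are algebraic, then every rational class of Hodge type `(n, n)`, `n = n₁ + n₂`,
in the Weil plane of `(A, φ)` is algebraic (`mem_algebraicClasses_of_isogeny_of_mem_weilClassesOf`:
`g^*` carries it into the Weil plane of the product, and `f^* g^* = m^{2n}`). Markman §11.5 Step 1:
components with the same `(n, K, det H)` "parametrize isogenous abelian varieties [van-Geemen]".
[cite: Markman2025SurveySecant, §11.5 Step 1] [cite: vanGeemen1994HodgeAV, 3.6–3.7]
[cite: Schoen1998HodgeWeilAddendum, §10] -/
theorem mem_algebraicClasses_of_isogeny_prod {n₁ n₂ d : ℕ} (hn₁ : 0 < n₁) (hd : 0 < d)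
    (hA₁ : A₁.dim = 2 * n₁) (hA₂ : A₂.dim = 2 * n₂) {φ₁ : A₁ ⟶ A₁} {φ₂ : A₂ ⟶ A₂}
    (hφ₁ : φ₁ ≫ φ₁ = -(d • 𝟙 A₁)) (hφ₂ : φ₂ ≫ φ₂ = -(d • 𝟙 A₂))
    (h₁ : weilClassesOf A₁ φ₁ n₁ d ≤ algebraicClasses A₁.X n₁)
    (h₂ : weilClassesOf A₂ φ₂ n₂ d ≤ algebraicClasses A₂.X n₂)
    {A : Motives.AbelianVariety ℂ} {φ : A ⟶ A} (hA : A.dim = 2 * (n₁ + n₂))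
    (MB : HodgeModel (2 * (n₁ + n₂)) (A₁.prod A₂).X) (f : A ⟶ A₁.prod A₂) (g : A₁.prod A₂ ⟶ A)
    [AlgebraicGeometry.Flat f.hom.hom.hom.left]
    (hg : g ≫ φ = Motives.AbelianVariety.prodLift (Motives.AbelianVariety.fst A₁ A₂ ≫ φ₁)
      (Motives.AbelianVariety.snd A₁ A₂ ≫ φ₂) ≫ g)
    {m : ℕ} (hm : 0 < m) (hfg : f ≫ g = m • 𝟙 A)
    {c : complexBetti A.X (2 * (n₁ + n₂))} (hc : IsRationalClass c)
    (hcH : IsOfHodgeType (2 * (n₁ + n₂)) A.X (2 * (n₁ + n₂)) (n₁ + n₂) (n₁ + n₂) c)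
    (hcW : c ∈ weilClassesOf A φ (n₁ + n₂) d) :
    c ∈ algebraicClasses A.X (n₁ + n₂) :=
  mem_algebraicClasses_of_isogeny_of_mem_weilClassesOf (Motives.isSmoothProjective_of_dim_eq' hA)
    (Motives.isSmoothProjective_of_dim_eq' (dim_prod_eq_two_mul hA₁ hA₂)) MB f g hg hm hfg
    (mem_algebraicClasses_prod_of_mem_weilClassesOf hn₁ hd hA₁ hA₂ hφ₁ hφ₂ h₁ h₂) hc hcH hcW

end HodgeTheory

end Literature.AlgebraicGeometry.HodgeTheory

end
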